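import Literature.Computability.AlgebraicComplexity.GKKSDepthFourProofs
import HarnessLib
import HarnessLib.Audit

/-!
# The counting ceiling of plain shifted partials sits below every depth-4 chasm door

File 1 of 2 (file 2 = `SPDChasmFloor`, the non-vacuity witness); route `Depth4`, lens-4
«depth-reduction / chasm axis» of the `decomp-valiant` workshop, generation 23.  Sorry-free; no
Literature fact; ONE `Prop` definition = the technique class `SPDCertifies` (+ the `ℕ` datum
`gateBound`); tree `GKKS.shifted`, `degLE`, `numSubsetsLE`, `finrank_shifted_le` USED BY NAME.

ONE CURRENCY.  `HasSPSPExpr f s D t` (tree, GKKS14 §1) = "`f` is a sum of `s` products of `D`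
polynomials of degree `≤ t`" (the `ΣΠ^{[D]}ΣΠ^{[t]}` model).  The TECHNIQUE CLASS of plain
shifted partials in this model is `SPDCertifies f s D t`: some order `k`, shift `ℓ` and family of
`k`-th order operators make the shifted-partials dimension of `f` exceed `s · gateBound`.
* §1 soundness `SPDCertifies f s D t → ¬ HasSPSPExpr f s D t` (tree `GKKS.finrank_shifted_le`);
* §2 THE COUNTING CEILING, for EVERY `f` of degree `≤ d`: dimension
  `≤ (if d ≤ k·t then 1 else |σ|^k) · gateBound` — order `k ≥ d/t` caps the space by the ambient
  degree `ℓ + d - k ≤ ℓ + k(t-1)`, order `k < d/t` by the `|σ|^k · #{γ : |γ| ≤ ℓ}` generators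
  `x^γ ∂_w f` over ALL words `w ∈ σ^k`; hence `¬ SPDCertifies f s D t` once `|σ|^((d-1)/t) ≤ s`;
* §3 the matrix instance `σ = Fin n × Fin n`, `deg f ≤ n`, `t = ⌊√n⌋`: NO certificate against top
  fan-in `s ≥ (n·n)^(⌊√n⌋+1)` for ANY `f`, ANY `D`; and every door instance dominates that
  threshold: the SHAPE `(n+2)^(a⌊√n⌋+a)` (`a ≥ 2`) and the tree's literal Tavenas fan-in
  `((4s(n+1)²)²)^(8n/(⌊√n⌋+1))` (`SLP.exists_sum_prod_component_hom`, every `s ≥ 1`).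
BARRIER READING (plain-SPD class, unconditional, every field): composing ANY shifted-partials
certificate with the chasm door refutes NO hypothesis `L(per_n) ≤ (n+2)^a` — the measure is too
small on every degree-`n` polynomial in `n²` variables (hypothesis-free SPD instance of the
barrier file's abstract `PolyMeasure.not_depth4_witness_of_vpSaturated`).  Honest grade: KNOWN in
print (GKKS14 §7 / Prop. 21; folklore, Kumar 2017 thesis p. 195; KLSS14 p. 3); kernel-new; crude
exponent; scope: plain SPD only (no restrictions / projections); rung 0.
-/

set_option linter.dupNamespace false

noncomputable section

open MvPolynomial
open Literature.Computability.AlgebraicComplexity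
open Literature.Computability.AlgebraicComplexity.GKKS

namespace Summit.ValiantsHypothesis.ValiantsHypothesis.Theorems.SPDChasmCeiling

/-! ### §1 The technique class of plain shifted partials in the `ΣΠ^{[D]}ΣΠ^{[t]}` model -/
section General

/-- The GKKS per-product bound (Cor. 10): a single product of `D` polynomials of degree `≤ t` has
shifted-partials dimension (order `k`, shift `≤ ℓ`) at most
`#{A ⊆ [D] : |A| ≤ k} · #{β : |β| ≤ ℓ + k(t-1)}`.
[cite: GuptaKamathKayalSaptharishi2014, Cor. 10] -/
def gateBound (σ : Type) [Fintype σ] (D k t ℓ : ℕ) : ℕ :=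
  numSubsetsLE D k * (degLE σ (ℓ + k * (t - 1))).card

variable {K : Type} [Field K] {σ : Type} [Fintype σ]

/-- **Technique class** `SPDCertifies f s D t`: a shifted-partials certificate that `f` has no
`ΣΠ^{[D]}ΣΠ^{[t]}` expression of top fan-in `s` — an order `k`, a shift bound `ℓ` and a finite
family of `k`-th order operators along which the shifted-partials space of `f` has dimension
`> s · gateBound` (GKKS 2014, §1 + Cor. 10).  A DEFINITION of the technique class (no cite tag: it
is not a named fact), as in `Depth4ChasmAxis`. -/
def SPDCertifies (f : MvPolynomial σ K) (s D t : ℕ) : Prop :=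
  ∃ (k ℓ : ℕ) (ι : Type) (_ : Fintype ι) (Ls : ι → List σ),
    (∀ i, (Ls i).length = k) ∧ s * gateBound σ D k t ℓ < Module.finrank K (shifted Ls ℓ f)

/-- **Soundness of the technique** (GKKS Cor. 10, tree `finrank_shifted_le`): a certificate excludes
every `ΣΠ^{[D]}ΣΠ^{[t]}` expression of top fan-in `s`.
[cite: GuptaKamathKayalSaptharishi2014, Cor. 10] -/
theorem not_hasSPSPExpr_of_spdCertifies {f : MvPolynomial σ K} {s D t : ℕ}
    (h : SPDCertifies f s D t) : ¬ HasSPSPExpr f s D t := by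
  rintro ⟨Q, hQ, hfQ⟩
  obtain ⟨k, ℓ, ι, hι, Ls, hLs, hlt⟩ := h
  have hle : Module.finrank K (shifted Ls ℓ f) ≤ s * gateBound σ D k t ℓ := by
    rw [hfQ, gateBound, ← mul_assoc]
    exact finrank_shifted_le Ls k hLs Q hQ
  exact absurd (hlt.trans_le hle) (lt_irrefl _)

/-- The class is antitone in `s`: a certificate against `s'` is one against every `s ≤ s'`.
[folklore] -/
theorem SPDCertifies.mono {f : MvPolynomial σ K} {s s' D t : ℕ} (h : SPDCertifies f s' D t)
    (hs : s ≤ s') : SPDCertifies f s D t := by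
  obtain ⟨k, ℓ, ι, hι, Ls, hLs, hlt⟩ := h
  exact ⟨k, ℓ, ι, hι, Ls, hLs, (Nat.mul_le_mul_right _ hs).trans_lt hlt⟩

/-! ### §2 The counting ceiling (valid for EVERY polynomial) -/

omit [Fintype σ] in
/-- A `k`-th order derivative lowers the total degree by `k` (or kills the polynomial).
[folklore] -/
theorem totalDegree_iterPderiv_add_le (L : List σ) (f : MvPolynomial σ K)
    (h : iterPderiv (K := K) L f ≠ 0) :
    (iterPderiv (K := K) L f).totalDegree + L.length ≤ f.totalDegree := by
  induction L with
  | nil => simp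
  | cons v L ih =>
    rw [iterPderiv_cons] at h ⊢
    have h' : iterPderiv (K := K) L f ≠ 0 := fun h0 => h (by rw [h0, map_zero])
    have h1 := totalDegree_pderiv_succ_le h
    have h2 := ih h'
    simp only [List.length_cons]
    omega

/-- A polynomial of total degree `≤ m` lies in the span of the monomials of degree `≤ m`.
[folklore] -/
theorem mem_span_monomial_degLE {p : MvPolynomial σ K} {m : ℕ} (hp : p.totalDegree ≤ m) :
    p ∈ Submodule.span K (Set.range fun β : degLE σ m => monomial (β : σ →₀ ℕ) (1 : K)) := by
  rw [p.as_sum]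
  refine Submodule.sum_mem _ fun β hβ => ?_
  have hβm : β ∈ degLE σ m := mem_degLE.2 ((degree_le_totalDegree hβ).trans hp)
  have : monomial β (coeff β p) = coeff β p • monomial β (1 : K) := by
    rw [smul_monomial, smul_eq_mul, mul_one]
  rw [this]
  exact Submodule.smul_mem _ _ (Submodule.subset_span ⟨⟨β, hβm⟩, rfl⟩)

/-- **Ceiling (a), ambient degree**: the shifted partials of order `k`, shift `≤ ℓ`, of an `f` of
degree `≤ d` are polynomials of degree `≤ ℓ + (d - k)`, so the space has dimension
`≤ #{β : |β| ≤ ℓ + (d-k)}`. [cite: GuptaKamathKayalSaptharishi2014, §7] -/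
theorem finrank_shifted_le_card_degLE {ι : Type} [Fintype ι] (Ls : ι → List σ) (k : ℕ)
    (hLs : ∀ i, (Ls i).length = k) (ℓ : ℕ) {f : MvPolynomial σ K} {d : ℕ}
    (hf : f.totalDegree ≤ d) :
    Module.finrank K (shifted Ls ℓ f) ≤ (degLE σ (ℓ + (d - k))).card := by
  classical
  have hle : shifted Ls ℓ f ≤ Submodule.span K
      (Set.range fun β : degLE σ (ℓ + (d - k)) => monomial (β : σ →₀ ℕ) (1 : K)) := by
    refine Submodule.span_le.mpr ?_
    rintro _ ⟨⟨i, γ⟩, rfl⟩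
    simp only [SetLike.mem_coe]
    refine mem_span_monomial_degLE ?_
    by_cases h0 : iterPderiv (K := K) (Ls i) f = 0
    · rw [h0, mul_zero, totalDegree_zero]; exact Nat.zero_le _
    · have h1 : (monomial (γ : σ →₀ ℕ) (1 : K)).totalDegree ≤ ℓ := by
        rw [totalDegree_monomial _ one_ne_zero, ← degree_eq_sum_id]
        exact mem_degLE.1 γ.2
      have h2 := totalDegree_iterPderiv_add_le (Ls i) f h0
      rw [hLs i] at h2
      refine (totalDegree_mul _ _).trans ?_
      omega
  haveI : Module.Finite K (Submodule.span K
      (Set.range fun β : degLE σ (ℓ + (d - k)) => monomial (β : σ →₀ ℕ) (1 : K))) :=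
    Module.Finite.span_of_finite K (Set.finite_range _)
  exact (Submodule.finrank_mono hle).trans
    ((finrank_range_le_card fun β : degLE σ (ℓ + (d - k)) => monomial (β : σ →₀ ℕ) (1 : K)).trans
      (Fintype.card_coe _).le)

/-- **Ceiling (b), number of generators**: whatever the family of order-`k` operators, the space
lies in the span of the `x^γ · ∂_w f` over ALL words `w ∈ σ^k`, `|γ| ≤ ℓ` (`∂_{L_i}` depends only
on the word `L_i`): `dim ≤ |σ|^k · #{γ : |γ| ≤ ℓ}`. [cite: GuptaKamathKayalSaptharishi2014, §7] -/
theorem finrank_shifted_le_pow_mul {ι : Type} [Fintype ι] (Ls : ι → List σ) (k : ℕ)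
    (hLs : ∀ i, (Ls i).length = k) (ℓ : ℕ) (f : MvPolynomial σ K) :
    Module.finrank K (shifted Ls ℓ f) ≤ Fintype.card σ ^ k * (degLE σ ℓ).card := by
  classical
  set w : List.Vector σ k × degLE σ ℓ → MvPolynomial σ K :=
    fun q => monomial (q.2 : σ →₀ ℕ) (1 : K) * iterPderiv q.1.toList f
  have hle : shifted Ls ℓ f ≤ Submodule.span K (Set.range w) := by
    refine Submodule.span_le.mpr ?_
    rintro _ ⟨⟨i, γ⟩, rfl⟩
    exact Submodule.subset_span ⟨(⟨Ls i, hLs i⟩, γ), rfl⟩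
  haveI : Module.Finite K (Submodule.span K (Set.range w)) :=
    Module.Finite.span_of_finite K (Set.finite_range w)
  calc Module.finrank K (shifted Ls ℓ f)
      ≤ Module.finrank K (Submodule.span K (Set.range w)) := Submodule.finrank_mono hle
    _ ≤ Fintype.card (List.Vector σ k × degLE σ ℓ) := finrank_range_le_card w
    _ = Fintype.card σ ^ k * (degLE σ ℓ).card := by
        rw [Fintype.card_prod, card_vector, Fintype.card_coe]

/-- `degLE` grows with the degree bound. [folklore] -/
theorem card_degLE_mono {L L' : ℕ} (h : L ≤ L') : (degLE σ L).card ≤ (degLE σ L').card :=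
  Finset.card_le_card fun _ hβ => mem_degLE.2 ((mem_degLE.1 hβ).trans h)

/-- There is always the empty subset: `#{A ⊆ [D] : |A| ≤ k} ≥ 1`. [folklore] -/
theorem numSubsetsLE_pos (D k : ℕ) : 0 < numSubsetsLE D k := by
  unfold numSubsetsLE
  exact Finset.card_pos.2 ⟨∅, Finset.mem_filter.2 ⟨Finset.mem_univ _, by simp⟩⟩

/-- **THE COUNTING CEILING**: for every `f` of degree `≤ d`, every order `k`, shift `ℓ`, family of
operators, and all `D`, `t`: `dim ≤ (if d ≤ k·t then 1 else |σ|^k) · gateBound` — so a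
shifted-partials certificate can never beat the factor in front.
[cite: GuptaKamathKayalSaptharishi2014, §7] -/
theorem finrank_shifted_le_ceiling {ι : Type} [Fintype ι] (Ls : ι → List σ) (k : ℕ)
    (hLs : ∀ i, (Ls i).length = k) (ℓ D t : ℕ) {f : MvPolynomial σ K} {d : ℕ}
    (hf : f.totalDegree ≤ d) :
    Module.finrank K (shifted Ls ℓ f) ≤
      (if d ≤ k * t then 1 else Fintype.card σ ^ k) * gateBound σ D k t ℓ := by
  have hG : ∀ L, L ≤ ℓ + k * (t - 1) → (degLE σ L).card ≤ gateBound σ D k t ℓ := fun L hL =>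
    (card_degLE_mono hL).trans (Nat.le_mul_of_pos_left _ (numSubsetsLE_pos D k))
  split_ifs with hdk
  · rw [one_mul]
    refine (finrank_shifted_le_card_degLE Ls k hLs ℓ hf).trans (hG _ ?_)
    have := Nat.mul_sub_one k t
    omega
  · exact (finrank_shifted_le_pow_mul Ls k hLs ℓ f).trans
      (Nat.mul_le_mul_left _ (hG _ (Nat.le_add_right _ _)))

/-- **No certificate above the ceiling**: if `|σ|^((d-1)/t) ≤ s` (`t ≥ 1`, `σ` inhabited), no
shifted-partials certificate against top fan-in `s` exists for any `f` of degree `≤ d`, any `D`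
(order `k·t ≥ d` certifies nothing, order `k ≤ (d-1)/t` at most `s < |σ|^k`).
[cite: GuptaKamathKayalSaptharishi2014, §7] -/
theorem not_spdCertifies_of_le [Nonempty σ] {f : MvPolynomial σ K} {d s D t : ℕ}
    (hf : f.totalDegree ≤ d) (ht : 1 ≤ t) (hs : Fintype.card σ ^ ((d - 1) / t) ≤ s) :
    ¬ SPDCertifies f s D t := by
  rintro ⟨k, ℓ, ι, hι, Ls, hLs, hlt⟩
  have hσ : 0 < Fintype.card σ := Fintype.card_pos
  have ht0 : 0 < t := Nat.lt_of_lt_of_le Nat.zero_lt_one ht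
  have hce := finrank_shifted_le_ceiling Ls k hLs ℓ D t hf
  have hfac : (if d ≤ k * t then 1 else Fintype.card σ ^ k) ≤ s := by
    split_ifs with hdk
    · exact Nat.succ_le_of_lt ((pow_pos hσ _).trans_le hs)
    · refine (Nat.pow_le_pow_right hσ ?_).trans hs
      rw [Nat.le_div_iff_mul_le ht0]
      omega
  exact absurd (hlt.trans_le (hce.trans (Nat.mul_le_mul_right _ hfac))) (lt_irrefl _)

end General

/-! ### §3 The square-matrix / chasm instance: `σ = Fin n × Fin n`, degree `≤ n`, `t = ⌊√n⌋` -/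

section Chasm

variable {K : Type} [Field K]

/-- `(n - 1) / ⌊√n⌋ ≤ ⌊√n⌋ + 1` (from `n < (⌊√n⌋ + 1)²`). [folklore] -/
theorem pred_div_sqrt_le (n : ℕ) : (n - 1) / Nat.sqrt n ≤ Nat.sqrt n + 1 := by
  rcases Nat.eq_zero_or_pos n with rfl | hn
  · simp
  set r := Nat.sqrt n
  have hr : 0 < r := Nat.sqrt_pos.2 hn
  have h : n < (r + 1) * (r + 1) := Nat.lt_succ_sqrt n
  refine Nat.lt_add_one_iff.1 ((Nat.div_lt_iff_lt_mul hr).2 ?_)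
  have e1 : (r + 1) * (r + 1) = r * r + 2 * r + 1 := by ring
  have e2 : (r + 1 + 1) * r = r * r + 2 * r := by ring
  omega

/-- **The chasm-axis ceiling**: for `n ≥ 1`, EVERY `f` of degree `≤ n` in the `n × n` matrix
variables and every `D`: no shifted-partials certificate against `ΣΠ^{[D]}ΣΠ^{[⌊√n⌋]}` top fan-in
`s ≥ (n·n)^(⌊√n⌋+1)`. [cite: GuptaKamathKayalSaptharishi2014, §7] -/
theorem not_spdCertifies_sqrt {n : ℕ} (hn : 1 ≤ n) (f : MvPolynomial (Fin n × Fin n) K)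
    (hf : f.totalDegree ≤ n) {s : ℕ} (hs : (n * n) ^ (Nat.sqrt n + 1) ≤ s) (D : ℕ) :
    ¬ SPDCertifies f s D (Nat.sqrt n) := by
  have hn0 : 0 < n := Nat.lt_of_lt_of_le Nat.zero_lt_one hn
  haveI : Nonempty (Fin n × Fin n) := ⟨(⟨0, hn0⟩, ⟨0, hn0⟩)⟩
  refine not_spdCertifies_of_le hf (Nat.succ_le_of_lt (Nat.sqrt_pos.2 hn0)) (le_trans ?_ hs)
  rw [Fintype.card_prod, Fintype.card_fin]
  exact Nat.pow_le_pow_right (mul_pos hn0 hn0) (pred_div_sqrt_le n)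

/-- The door SHAPE dominates the ceiling: `(n·n)^(⌊√n⌋+1) ≤ (n+2)^(a⌊√n⌋+a)` for every
`a ≥ 2` (the tree's depth-reduction doors all have this shape). [folklore] -/
theorem ceiling_le_doorShape (n : ℕ) {a : ℕ} (ha : 2 ≤ a) :
    (n * n) ^ (Nat.sqrt n + 1) ≤ (n + 2) ^ (a * Nat.sqrt n + a) := by
  calc (n * n) ^ (Nat.sqrt n + 1)
      ≤ ((n + 2) * (n + 2)) ^ (Nat.sqrt n + 1) :=
        Nat.pow_le_pow_left (Nat.mul_le_mul (Nat.le_add_right n 2) (Nat.le_add_right n 2)) _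
    _ = (n + 2) ^ (2 * (Nat.sqrt n + 1)) := by rw [← pow_two, ← pow_mul]
    _ ≤ (n + 2) ^ (a * Nat.sqrt n + a) :=
        Nat.pow_le_pow_right (by omega) (by nlinarith [ha, Nat.zero_le (Nat.sqrt n)])

/-- The tree's literal Tavenas top fan-in (`SLP.exists_sum_prod_component_hom` at degree `n`, cut
`t = ⌊√n⌋`, program length `s ≥ 1`) dominates the ceiling: `8n/(⌊√n⌋+1) ≥ 4⌊√n⌋` and
`(4s(n+1)²)² ≥ (n·n)²`. [cite: Tavenas2015, Thm. 1] -/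
theorem ceiling_le_tavenasDoor {n s : ℕ} (hn : 1 ≤ n) (hs : 1 ≤ s) :
    (n * n) ^ (Nat.sqrt n + 1) ≤
      ((4 * s * (n + 1) ^ 2) * (4 * s * (n + 1) ^ 2)) ^ (8 * n / (Nat.sqrt n + 1)) := by
  have hn0 : 0 < n := Nat.lt_of_lt_of_le Nat.zero_lt_one hn
  have hr : 0 < Nat.sqrt n := Nat.sqrt_pos.2 hn0
  have hrr : Nat.sqrt n * Nat.sqrt n ≤ n := Nat.sqrt_le n
  have hq : 4 * Nat.sqrt n ≤ 8 * n / (Nat.sqrt n + 1) := by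
    rw [Nat.le_div_iff_mul_le (Nat.succ_pos _)]
    nlinarith [Nat.le_mul_self (Nat.sqrt n), hrr, hr]
  have hB : n * n ≤ 4 * s * (n + 1) ^ 2 :=
    calc n * n ≤ (n + 1) ^ 2 := by nlinarith
      _ ≤ 4 * s * (n + 1) ^ 2 := Nat.le_mul_of_pos_left _ (by omega)
  calc (n * n) ^ (Nat.sqrt n + 1)
      ≤ (n * n) ^ (2 * (8 * n / (Nat.sqrt n + 1))) :=
        Nat.pow_le_pow_right (mul_pos hn0 hn0) (by omega)
    _ = ((n * n) * (n * n)) ^ (8 * n / (Nat.sqrt n + 1)) := by rw [pow_mul, pow_two]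
    _ ≤ ((4 * s * (n + 1) ^ 2) * (4 * s * (n + 1) ^ 2)) ^ (8 * n / (Nat.sqrt n + 1)) :=
        Nat.pow_le_pow_left (Nat.mul_le_mul hB hB) _

/-- **BARRIER, door-shape form**: for every `a ≥ 2`, `n ≥ 1`, every `f` of degree `≤ n` on the
matrix variables and every `D`: no shifted-partials certificate against `ΣΠ^{[D]}ΣΠ^{[⌊√n⌋]}`
top fan-in `(n+2)^(a⌊√n⌋+a)`. [cite: GuptaKamathKayalSaptharishi2014, §7] -/
theorem not_spdCertifies_doorShape {n a : ℕ} (hn : 1 ≤ n) (ha : 2 ≤ a)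
    (f : MvPolynomial (Fin n × Fin n) K) (hf : f.totalDegree ≤ n) (D : ℕ) :
    ¬ SPDCertifies f ((n + 2) ^ (a * Nat.sqrt n + a)) D (Nat.sqrt n) :=
  not_spdCertifies_sqrt hn f hf (ceiling_le_doorShape n ha) D

/-- **BARRIER, literal-door form**: no shifted-partials certificate refutes the Tavenas normal
form (top fan-in `((4s(n+1)²)²)^(8n/(⌊√n⌋+1))`, cut `⌊√n⌋`) of ANY straight-line program of ANY
length `s ≥ 1` at degree `n`.
[cite: Tavenas2015, Thm. 1] [cite: GuptaKamathKayalSaptharishi2014, §7] -/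
theorem not_spdCertifies_tavenasDoor {n s : ℕ} (hn : 1 ≤ n) (hs : 1 ≤ s)
    (f : MvPolynomial (Fin n × Fin n) K) (hf : f.totalDegree ≤ n) (D : ℕ) :
    ¬ SPDCertifies f (((4 * s * (n + 1) ^ 2) * (4 * s * (n + 1) ^ 2)) ^ (8 * n / (Nat.sqrt n + 1)))
      D (Nat.sqrt n) :=
  not_spdCertifies_sqrt hn f hf (ceiling_le_tavenasDoor hn hs) D

end Chasm

end Summit.ValiantsHypothesis.ValiantsHypothesis.Theorems.SPDChasmCeiling

end
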